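import Literature.Computability.AlgebraicComplexity.IMMInVPProofs
import Literature.Computability.AlgebraicComplexity.IMMWalkExpansion
import Literature.Computability.AlgebraicComplexity.FSV2018ROABP
import Literature.Barriers.ValiantsHypothesis.AlgebraicNaturalProofs
import Summits.ValiantsHypothesis.ValiantsHypothesis.Theses.BarrierLever
import Mathlib.Data.Complex.Basic

/-!
# Route BarrierLever — item `PartitionMinorsHitByVP` (stmt-ValiantsHypothesis-19717): the ROABP DOOR
Helper file (`--supports stmt-ValiantsHypothesis-19717`; cell valiant-natproofs, rung V4, 𝒟-side; AUTHOR planner p1 g16 — text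
HOME/p1/g16/BarrierLeverPartitionMinorsHitByVPRoabpDoor.lean v2, landed verbatim up to four added docstrings and this header by
val-np-p7 g15 under the owner table's timed fallback; owner lineage val-np-p6). Closes NO item: the arrow is CONDITIONAL on the
`@[conjecture]` def `ROABPHitsPartitionMinors` (killable; census/memo HOME/p1/g16/MEMO-ttdoor-g16.md).
* Witness `roabpWitness h m π P Q l rr = aeval g (immPoly m (2h+1) ℂ)`, `g (t,i,j) = C (P t i j) + C (Q t i j) * X (π t)` (`t < 2h`),
  `g (2h,i,j) = C (rr i * l j)` (rank-one closing layer), i.e. `f = lᵀ ∏_{t<2h} (P_t + z_{π t} Q_t) rr`. SIZE by citation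
  (`complexity_aeval_le` + `complexity_immPoly_le`), DEGREE `≤ 2h`, MEMBERSHIP `roabpWitness_mem_smallCircuits` (`m ≤ (2h)^c`, `4 ≤ 2h`
  ⇒ `SmallCircuits ℂ (2h) (3c+3)`); COEFFICIENT FORMULA `coeff_roabpWitness`: `coeff_{x^A y^B} f = l ⬝ᵥ (∏_t M_t) *ᵥ rr`, `M_t = Q_t` iff
  `π t ∈ monoVars A B` (walk expansion `IMMWalk.immPoly_eq_sum_closedWalks` + `coeff_expAB_prod_affine` + [ForbesShpilkaVolk2018 §5.3]).
* DOOR `partitionMinor_hit_of_roabpCertificate` (item's matrix verbatim), CONJECTURE OF RECORD `@[conjecture] ROABPHitsPartitionMinors`,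
  ARROW `partitionMinorsHitByVP_of_roabp` (b = 3c+3); TOY KERNEL CERTIFICATE (last `example`): `∏_a (1 + x_a y_a)` as a width-2 ROABP,
  order x₀ y₀ x₁ y₁, full 2-cube layout, `roabpCertMatrix = 1` ⇒ hit in `SmallCircuits ℂ (2+2) 6` through the door.
Class theorems (NFA / transducer certificates): `…RoabpNfa.lean`, `…RoabpTransducer.lean`. WHAT THIS IS NOT: not a proof of 19717
(the conjecture is open); nothing on crux 14610 or on VP ≠ VNP.
-/

open MvPolynomial Literature.Computability.AlgebraicComplexity

namespace Summit.ValiantsHypothesis.Theorems.BarrierLever.RoabpDoor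

open Summit.ValiantsHypothesis.ValiantsHypothesis.Theses.BarrierLever (PartitionMinorsHitByVP)

variable {σ : Type*}

/-- Each substituted entry is an affine form `C a + C b * X v` of complexity ≤ 2. -/
theorem complexity_affine_le (a b : ℂ) (v : σ) :
    complexity (C a + C b * X v : MvPolynomial σ ℂ) ≤ 2 := by
  have h1 := complexity_add_le_holds (k := ℂ) (σ := σ) (C a) (C b * X v)
  have h2 := complexity_mul_le_holds (k := ℂ) (σ := σ) (C b) (X v)
  have h3 := complexity_C_holds (k := ℂ) (σ := σ) a
  have h4 := complexity_C_holds (k := ℂ) (σ := σ) b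
  have h5 := complexity_X_holds (k := ℂ) (σ := σ) v
  omega

/-- The substitution of the door: affine forms on the `d` variable layers, constants on the closing layer. -/
noncomputable def roabpSubst (h m : ℕ) (π : Equiv.Perm (Fin (h + h)))
    (P Q : Fin (h + h) → Matrix (Fin m) (Fin m) ℂ) (l rr : Fin m → ℂ) :
    Fin (h + h + 1) × Fin m × Fin m → MvPolynomial (Fin (h + h)) ℂ := fun x =>
  if ht : (x.1 : ℕ) < h + h then
    C (P ⟨x.1, ht⟩ x.2.1 x.2.2) + C (Q ⟨x.1, ht⟩ x.2.1 x.2.2) * X (π ⟨x.1, ht⟩)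
  else C (rr x.2.1 * l x.2.2)

/-- Every substituted entry of the door has complexity ≤ 2. -/
theorem complexity_roabpSubst_le (h m : ℕ) (π : Equiv.Perm (Fin (h + h)))
    (P Q : Fin (h + h) → Matrix (Fin m) (Fin m) ℂ) (l rr : Fin m → ℂ) (x) :
    complexity (roabpSubst h m π P Q l rr x) ≤ 2 := by
  unfold roabpSubst
  split_ifs with ht
  · exact complexity_affine_le _ _ _
  · rw [complexity_C_holds (k := ℂ) (σ := Fin (h + h))]; exact Nat.zero_le _

/-- The door witness as a substitution instance of `IMM`. -/
noncomputable def roabpWitness (h m : ℕ) (π : Equiv.Perm (Fin (h + h)))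
    (P Q : Fin (h + h) → Matrix (Fin m) (Fin m) ℂ) (l rr : Fin m → ℂ) : MvPolynomial (Fin (h + h)) ℂ :=
  aeval (roabpSubst h m π P Q l rr) (immPoly m (h + h + 1) ℂ)

/-- **Size half of the door, by citation**: `L(f) ≤ m + 2 m³ (2h+1) + 2 (2h+1) m²`. -/
theorem complexity_roabpWitness_le (h m : ℕ) (π : Equiv.Perm (Fin (h + h)))
    (P Q : Fin (h + h) → Matrix (Fin m) (Fin m) ℂ) (l rr : Fin m → ℂ) :
    complexity (roabpWitness h m π P Q l rr) ≤ m + 2 * m ^ 3 * (h + h + 1) + 2 * ((h + h + 1) * m * m) := by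
  unfold roabpWitness
  refine (complexity_aeval_le _ _).trans ?_
  have h1 := complexity_immPoly_le (N := m) (k := ℂ) (h + h + 1)
  have h2 : ∑ x : Fin (h + h + 1) × Fin m × Fin m, complexity (roabpSubst h m π P Q l rr x)
      ≤ 2 * ((h + h + 1) * m * m) := by
    calc ∑ x : Fin (h + h + 1) × Fin m × Fin m, complexity (roabpSubst h m π P Q l rr x)
        ≤ ∑ _x : Fin (h + h + 1) × Fin m × Fin m, 2 :=
          Finset.sum_le_sum fun x _ => complexity_roabpSubst_le h m π P Q l rr x
      _ = 2 * ((h + h + 1) * m * m) := by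
          simp [Finset.sum_const, Finset.card_univ, Fintype.card_prod, Fintype.card_fin]; ring
  omega

/-- The `x^A y^B` exponent of the partition layout (`x_a = X (castAdd h a)`, `y_c = X (natAdd h c)`). -/
noncomputable def expAB (h : ℕ) (A B : Finset (Fin h)) : Fin (h + h) →₀ ℕ :=
  ∑ a ∈ A, Finsupp.single (Fin.castAdd h a) 1 + ∑ c ∈ B, Finsupp.single (Fin.natAdd h c) 1

/-- The variables of the monomial `x^A y^B`. -/
def monoVars (h : ℕ) (A B : Finset (Fin h)) : Finset (Fin (h + h)) :=
  A.image (Fin.castAdd h) ∪ B.image (Fin.natAdd h)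

/-- Indicator sums of singles. -/
theorem sum_single_one_apply {σ : Type*} [DecidableEq σ] (s : Finset σ) (v : σ) :
    (∑ w ∈ s, Finsupp.single w (1 : ℕ)) v = if v ∈ s then 1 else 0 := by
  rw [Finsupp.finsetSum_apply]
  simp only [Finsupp.single_apply]
  rw [Finset.sum_ite_eq']

/-- The `x`-images and the `y`-images of coordinates are disjoint variable sets. -/
theorem disjoint_images (h : ℕ) (A B : Finset (Fin h)) :
    Disjoint (A.image (Fin.castAdd h)) (B.image (Fin.natAdd h)) := by
  classical
  rw [Finset.disjoint_left]
  intro v h1 h2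
  rw [Finset.mem_image] at h1 h2
  obtain ⟨a, _, rfl⟩ := h1
  obtain ⟨c, _, hc⟩ := h2
  have := congrArg Fin.val hc
  simp at this
  omega

/-- The exponent `x^A y^B` is the sum of singles over `monoVars`. -/
theorem expAB_eq_sum (h : ℕ) (A B : Finset (Fin h)) :
    expAB h A B = ∑ v ∈ monoVars h A B, Finsupp.single v 1 := by
  classical
  unfold expAB monoVars
  rw [Finset.sum_union (disjoint_images h A B),
    Finset.sum_image fun a _ b _ hab => Fin.castAdd_injective _ _ hab,
    Finset.sum_image fun a _ b _ hab => Fin.natAdd_injective _ _ hab]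

/-- The exponent of a set `u` of layers, pushed through `π`. -/
theorem layerExp_eq (h : ℕ) (π : Equiv.Perm (Fin (h + h))) (u : Finset (Fin (h + h))) :
    (∑ i ∈ u, Finsupp.single (π i) (1 : ℕ)) = ∑ v ∈ u.image π, Finsupp.single v 1 := by
  classical
  rw [Finset.sum_image fun a _ b _ hab => π.injective hab]

/-- The exponent of a set of layers equals `x^A y^B` iff the layers are exactly those mapped by `π` into `monoVars A B`. -/
theorem layerExp_eq_expAB_iff (h : ℕ) (π : Equiv.Perm (Fin (h + h))) (u : Finset (Fin (h + h)))
    (A B : Finset (Fin h)) :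
    (∑ i ∈ u, Finsupp.single (π i) (1 : ℕ)) = expAB h A B ↔
      u = Finset.univ.filter fun i => π i ∈ monoVars h A B := by
  classical
  rw [layerExp_eq, expAB_eq_sum]
  constructor
  · intro hu
    have himg : u.image π = monoVars h A B := by
      ext v
      have := congrArg (fun f => f v) hu
      simp only [sum_single_one_apply] at this
      by_cases h1 : v ∈ u.image π <;> by_cases h2 : v ∈ monoVars h A B <;> simp_all
    ext i
    simp only [Finset.mem_filter, Finset.mem_univ, true_and]
    rw [← himg, Finset.mem_image]
    constructor
    · intro hi; exact ⟨i, hi, rfl⟩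
    · rintro ⟨j, hj, hji⟩; rwa [← π.injective hji]
  · rintro rfl
    congr 1
    ext v
    simp only [Finset.mem_image, Finset.mem_filter, Finset.mem_univ, true_and]
    constructor
    · rintro ⟨i, hi, rfl⟩; exact hi
    · intro hv; exact ⟨π.symm v, by simpa using hv, by simp⟩

/-- A product of scaled variables is a scaled monomial. -/
theorem prod_C_mul_X (h : ℕ) (π : Equiv.Perm (Fin (h + h))) (q : Fin (h + h) → ℂ) (u : Finset (Fin (h + h))) :
    (∏ i ∈ u, (C (q i) * X (π i) : MvPolynomial (Fin (h + h)) ℂ)) =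
      C (∏ i ∈ u, q i) * monomial (∑ i ∈ u, Finsupp.single (π i) 1) 1 := by
  rw [Finset.prod_mul_distrib, map_prod, monomial_sum_one]
  rfl

/-- **Multilinear coefficient extraction**: the `x^A y^B`-coefficient of `∏_i (C p_i + C q_i · X (π i))` (π a
permutation of the variables) picks `q_i` when `π i ∈ monoVars A B` and `p_i` otherwise. -/
theorem coeff_expAB_prod_affine (h : ℕ) (π : Equiv.Perm (Fin (h + h))) (p q : Fin (h + h) → ℂ)
    (A B : Finset (Fin h)) :
    coeff (expAB h A B) (∏ i : Fin (h + h), (C (p i) + C (q i) * X (π i) : MvPolynomial (Fin (h + h)) ℂ)) =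
      ∏ i : Fin (h + h), (if π i ∈ monoVars h A B then q i else p i) := by
  classical
  set t₀ : Finset (Fin (h + h)) := Finset.univ.filter fun i => π i ∈ monoVars h A B with ht₀
  rw [Finset.prod_add, coeff_sum]
  -- each term: `(∏_{i∈t} C p_i) * ∏_{i ∈ univ \ t} (C q_i * X (π i))`
  have hterm : ∀ t ∈ (Finset.univ : Finset (Fin (h + h))).powerset,
      coeff (expAB h A B) ((∏ i ∈ t, (C (p i) : MvPolynomial (Fin (h + h)) ℂ)) *
          ∏ i ∈ Finset.univ \ t, (C (q i) * X (π i) : MvPolynomial (Fin (h + h)) ℂ)) =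
        if Finset.univ \ t = t₀ then (∏ i ∈ t, p i) * ∏ i ∈ Finset.univ \ t, q i else 0 := by
    intro t _
    rw [prod_C_mul_X, ← map_prod C, ← mul_assoc, ← map_mul, coeff_C_mul, coeff_monomial]
    by_cases hu : Finset.univ \ t = t₀
    · rw [if_pos ((layerExp_eq_expAB_iff h π _ A B).2 hu), if_pos hu, mul_one]
    · rw [if_neg (fun h' => hu ((layerExp_eq_expAB_iff h π _ A B).1 h')), if_neg hu, mul_zero]
  rw [Finset.sum_congr rfl hterm, Finset.sum_ite, Finset.sum_const_zero, add_zero]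
  -- exactly one `t` has `univ \ t = t₀`, namely `t = univ \ t₀`
  have hfilter : ((Finset.univ : Finset (Fin (h + h))).powerset.filter fun t => Finset.univ \ t = t₀) =
      {Finset.univ \ t₀} := by
    ext t
    simp only [Finset.mem_filter, Finset.mem_powerset, Finset.subset_univ, true_and,
      Finset.mem_singleton]
    constructor
    · intro ht; rw [← ht, sdiff_sdiff_right_self, Finset.inf_eq_inter, Finset.univ_inter]
    · intro ht; rw [ht, sdiff_sdiff_right_self, Finset.inf_eq_inter, Finset.univ_inter]
  rw [hfilter, Finset.sum_singleton, sdiff_sdiff_right_self, Finset.inf_eq_inter,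
    Finset.univ_inter, Finset.prod_ite]
  -- regroup the two products into one `ite` product
  have hp : (Finset.univ \ t₀) = Finset.univ.filter (fun i => ¬ (π i ∈ monoVars h A B)) := by
    ext i; simp [ht₀]
  rw [hp]
  exact mul_comm _ _

/-- The substitution on an inner layer `i < 2h` of the walk `v`. -/
theorem roabpSubst_castSucc (h m : ℕ) (π : Equiv.Perm (Fin (h + h)))
    (P Q : Fin (h + h) → Matrix (Fin m) (Fin m) ℂ) (l rr : Fin m → ℂ) (i : Fin (h + h)) (a b : Fin m) :
    roabpSubst h m π P Q l rr (i.castSucc, a, b) = C (P i a b) + C (Q i a b) * X (π i) := by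
  unfold roabpSubst
  have hi : ((i.castSucc : Fin (h + h + 1)) : ℕ) < h + h := by simp [i.is_lt]
  rw [dif_pos hi]
  have e : (⟨((i.castSucc : Fin (h + h + 1)) : ℕ), hi⟩ : Fin (h + h)) = i := Fin.ext rfl
  dsimp only
  rw [e]

/-- The substitution on the closing layer `2h`. -/
theorem roabpSubst_last (h m : ℕ) (π : Equiv.Perm (Fin (h + h)))
    (P Q : Fin (h + h) → Matrix (Fin m) (Fin m) ℂ) (l rr : Fin m → ℂ) (a b : Fin m) :
    roabpSubst h m π P Q l rr (Fin.last (h + h), a, b) = C (rr a * l b) := by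
  unfold roabpSubst
  rw [dif_neg (by simp)]

/-- **Coefficient formula, walk-sum form**: the `x^A y^B`-coefficient of the witness is the sum over state
sequences `v₀ … v_{2h}` of `∏_t M_t[v_t, v_{t+1}] · rr(v_{2h}) · l(v₀)` with `M_t = Q_t` if `π t ∈ monoVars A B`, else `P_t`. -/
theorem coeff_roabpWitness_walkSum (h m : ℕ) (π : Equiv.Perm (Fin (h + h)))
    (P Q : Fin (h + h) → Matrix (Fin m) (Fin m) ℂ) (l rr : Fin m → ℂ) (A B : Finset (Fin h)) :
    coeff (expAB h A B) (roabpWitness h m π P Q l rr) =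
      ∑ v : Fin (h + h + 1) → Fin m,
        (∏ i : Fin (h + h), (if π i ∈ monoVars h A B then Q i else P i) (v i.castSucc) (v i.succ)) *
          (rr (v (Fin.last (h + h))) * l (v 0)) := by
  classical
  unfold roabpWitness
  rw [IMMWalk.immPoly_eq_sum_closedWalks m (h + h + 1) ℂ (Nat.succ_pos _), map_sum, coeff_sum]
  refine Finset.sum_congr rfl fun v _ => ?_
  rw [← IMMWalk.prod_X_closedWalk, map_prod]
  simp only [aeval_X]
  rw [Fin.prod_univ_castSucc, finRotate_last, roabpSubst_last]
  have hstep : ∀ i : Fin (h + h),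
      roabpSubst h m π P Q l rr (i.castSucc, v i.castSucc, v (finRotate (h + h + 1) i.castSucc)) =
        C (P i (v i.castSucc) (v i.succ)) + C (Q i (v i.castSucc) (v i.succ)) * X (π i) := by
    intro i
    -- `finRotate (n+1) i.castSucc = i.succ` (= `Literature.Computability.Complexity.finRotate_castSucc_eq`, inlined)
    have hrot : finRotate (h + h + 1) i.castSucc = i.succ := by
      apply Fin.ext
      have := IMMWalk.val_finRotate (Nat.succ_pos (h + h)) i.castSucc
      rw [if_pos (by simp [i.is_lt])] at this
      rw [this]; simp
    rw [hrot, roabpSubst_castSucc]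
  rw [Finset.prod_congr rfl fun i _ => hstep i]
  rw [show (∏ i : Fin (h + h), (C (P i (v i.castSucc) (v i.succ)) + C (Q i (v i.castSucc) (v i.succ)) * X (π i) :
      MvPolynomial (Fin (h + h)) ℂ)) * C (rr (v (Fin.last (h + h))) * l (v 0)) =
      C (rr (v (Fin.last (h + h))) * l (v 0)) * ∏ i : Fin (h + h), (C (P i (v i.castSucc) (v i.succ)) +
        C (Q i (v i.castSucc) (v i.succ)) * X (π i)) from mul_comm _ _, coeff_C_mul,
    coeff_expAB_prod_affine h π (fun i => P i (v i.castSucc) (v i.succ))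
      (fun i => Q i (v i.castSucc) (v i.succ)) A B, mul_comm]
  congr 1
  refine Finset.prod_congr rfl fun i _ => ?_
  split_ifs <;> rfl

open Matrix in
/-- **Coefficient formula (the correctness half of the door)**: `coeff_{x^A y^B} f = lᵀ (∏_t M_t) rr` with
`M_t = Q_t` if `π t ∈ monoVars A B` and `P_t` otherwise — the walk sum re-summed by the roABP path expansion
`ROABP.dotProduct_listProd_mulVec` [ForbesShpilkaVolk2018 §5.3]. -/
theorem coeff_roabpWitness (h m : ℕ) (π : Equiv.Perm (Fin (h + h)))
    (P Q : Fin (h + h) → Matrix (Fin m) (Fin m) ℂ) (l rr : Fin m → ℂ) (A B : Finset (Fin h)) :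
    coeff (expAB h A B) (roabpWitness h m π P Q l rr) =
      l ⬝ᵥ ((List.ofFn fun t : Fin (h + h) => if π t ∈ monoVars h A B then Q t else P t).prod *ᵥ rr) := by
  rw [coeff_roabpWitness_walkSum, dotProduct_listProd_mulVec]
  refine Finset.sum_congr rfl fun v _ => ?_
  ring

/-- Each substituted entry has total degree ≤ 1, and the closing layer has degree 0. -/
theorem totalDegree_roabpSubst_le (h m : ℕ) (π : Equiv.Perm (Fin (h + h)))
    (P Q : Fin (h + h) → Matrix (Fin m) (Fin m) ℂ) (l rr : Fin m → ℂ) (x) :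
    (roabpSubst h m π P Q l rr x).totalDegree ≤ if (x.1 : ℕ) < h + h then 1 else 0 := by
  unfold roabpSubst
  split_ifs with ht
  · refine (totalDegree_add _ _).trans (max_le ?_ ?_)
    · simp
    · refine (totalDegree_mul _ _).trans ?_
      simp
  · exact (totalDegree_C _).le

/-- The DEGREE half (PROVED): every closed-walk monomial of `immPoly m (2h+1)` reads one variable per layer
(`immPoly_eq_sum_closedWalks`, `prod_X_closedWalk`); the closing layer is substituted by constants and the
others by forms of degree ≤ 1, so the witness has total degree ≤ 2h. -/
theorem totalDegree_roabpWitness_le (h m : ℕ) (π : Equiv.Perm (Fin (h + h)))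
    (P Q : Fin (h + h) → Matrix (Fin m) (Fin m) ℂ) (l rr : Fin m → ℂ) :
    (roabpWitness h m π P Q l rr).totalDegree ≤ h + h := by
  unfold roabpWitness
  rw [IMMWalk.immPoly_eq_sum_closedWalks m (h + h + 1) ℂ (Nat.succ_pos _), map_sum]
  refine (totalDegree_finsetSum _ _).trans (Finset.sup_le fun v _ => ?_)
  rw [← IMMWalk.prod_X_closedWalk, map_prod]
  simp only [aeval_X]
  refine (totalDegree_finsetProd _ _).trans ?_
  calc ∑ t : Fin (h + h + 1), (roabpSubst h m π P Q l rr (t, v t, v (finRotate (h + h + 1) t))).totalDegree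
      ≤ ∑ t : Fin (h + h + 1), (if ((t, v t, v (finRotate (h + h + 1) t)).1 : ℕ) < h + h then 1 else 0) :=
        Finset.sum_le_sum fun t _ => totalDegree_roabpSubst_le h m π P Q l rr _
    _ = h + h := by
        rw [Fin.sum_univ_castSucc]
        simp [Fin.is_lt]

/-- Arithmetic: for `m ≤ n^c` and `4 ≤ n`, `m + 2 m³ (n+1) + 2 (n+1) m² ≤ n^(3c+3)`. -/
theorem size_arith (n m c : ℕ) (hm : m ≤ n ^ c) (hn : 4 ≤ n) :
    m + 2 * m ^ 3 * (n + 1) + 2 * ((n + 1) * m * m) ≤ n ^ (3 * c + 3) := by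
  have hn1 : 1 ≤ n := by omega
  have h3 : m ^ 3 ≤ n ^ (3 * c) := by
    rw [mul_comm 3 c, pow_mul]; exact Nat.pow_le_pow_left hm 3
  have hc : n ^ c ≤ n ^ (3 * c) := Nat.pow_le_pow_right hn1 (by omega)
  have h1 : m ≤ n ^ (3 * c) := hm.trans hc
  have h2 : m * m ≤ n ^ (3 * c) := by
    have : m * m ≤ n ^ c * n ^ c := Nat.mul_le_mul hm hm
    refine this.trans ?_
    rw [← pow_add]; exact Nat.pow_le_pow_right hn1 (by omega)
  calc m + 2 * m ^ 3 * (n + 1) + 2 * ((n + 1) * m * m)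
      ≤ n ^ (3 * c) + 2 * n ^ (3 * c) * (n + 1) + 2 * ((n + 1) * n ^ (3 * c)) := by
        refine Nat.add_le_add (Nat.add_le_add h1 ?_) ?_
        · exact Nat.mul_le_mul (Nat.mul_le_mul_left 2 h3) le_rfl
        · refine Nat.mul_le_mul_left 2 ?_
          rw [mul_assoc]; exact Nat.mul_le_mul_left (n + 1) h2
    _ = n ^ (3 * c) * (4 * n + 5) := by ring
    _ ≤ n ^ (3 * c) * n ^ 3 := by
        refine Nat.mul_le_mul_left _ ?_
        have h16 : 16 * n ≤ n ^ 3 := by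
          calc 16 * n = 4 * 4 * n := by ring
            _ ≤ n * n * n := Nat.mul_le_mul (Nat.mul_le_mul hn hn) le_rfl
            _ = n ^ 3 := by ring
        omega
    _ = n ^ (3 * c + 3) := by rw [← pow_add]

/-- **Membership (PROVED modulo nothing): for `m ≤ (2h)^c` and `h ≥ 2` the door witness lies in
`SmallCircuits ℂ (h+h) (3c+3)`.** -/
theorem roabpWitness_mem_smallCircuits (h m c : ℕ) (hm : m ≤ (h + h) ^ c) (hh : 4 ≤ h + h)
    (π : Equiv.Perm (Fin (h + h))) (P Q : Fin (h + h) → Matrix (Fin m) (Fin m) ℂ) (l rr : Fin m → ℂ) :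
    roabpWitness h m π P Q l rr ∈ Literature.Barriers.ValiantsHypothesis.SmallCircuits ℂ (h + h) (3 * c + 3) := by
  refine ⟨totalDegree_roabpWitness_le h m π P Q l rr, ?_⟩
  exact (complexity_roabpWitness_le h m π P Q l rr).trans (size_arith (h + h) m c hm hh)

open Matrix in
/-- The ROABP layout matrix of a certificate `(π, P, Q, l, rr)` on the layout `(u, w)`: entry `(i, j)` is
`lᵀ (∏_t M_t) rr` with `M_t = Q_t` if `π t ∈ monoVars (u i) (w j)`, else `P_t` (computable from the tables). -/
noncomputable def roabpCertMatrix {h m r : ℕ} (u w : Fin r → Finset (Fin h)) (π : Equiv.Perm (Fin (h + h)))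
    (P Q : Fin (h + h) → Matrix (Fin m) (Fin m) ℂ) (l rr : Fin m → ℂ) : Matrix (Fin r) (Fin r) ℂ :=
  Matrix.of fun i j => l ⬝ᵥ ((List.ofFn fun t : Fin (h + h) =>
    if π t ∈ monoVars h (u i) (w j) then Q t else P t).prod *ᵥ rr)

/-- **THE DOOR** (`--supports 19717`): an ROABP certificate of width `m ≤ (2h)^c` with nonsingular layout matrix
hits the partition minor `(u, w)` inside `SmallCircuits ℂ (2h) (3c+3)` — the item's matrix verbatim. -/
theorem partitionMinor_hit_of_roabpCertificate (h m c : ℕ) (hm : m ≤ (h + h) ^ c) (hh : 4 ≤ h + h)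
    {r : ℕ} (u w : Fin r → Finset (Fin h)) (π : Equiv.Perm (Fin (h + h)))
    (P Q : Fin (h + h) → Matrix (Fin m) (Fin m) ℂ) (l rr : Fin m → ℂ)
    (hdet : (roabpCertMatrix u w π P Q l rr).det ≠ 0) :
    ∃ f ∈ Literature.Barriers.ValiantsHypothesis.SmallCircuits ℂ (h + h) (3 * c + 3),
      (Matrix.of fun i j : Fin r => MvPolynomial.coeff
        (∑ a ∈ u i, Finsupp.single (Fin.castAdd h a) 1 + ∑ c ∈ w j, Finsupp.single (Fin.natAdd h c) 1) f).det ≠ 0 := by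
  refine ⟨roabpWitness h m π P Q l rr, roabpWitness_mem_smallCircuits h m c hm hh π P Q l rr, ?_⟩
  have hmat : (Matrix.of fun i j : Fin r => MvPolynomial.coeff
      (∑ a ∈ u i, Finsupp.single (Fin.castAdd h a) 1 + ∑ c ∈ w j, Finsupp.single (Fin.natAdd h c) 1)
        (roabpWitness h m π P Q l rr)) = roabpCertMatrix u w π P Q l rr := by
    ext i j
    simp only [Matrix.of_apply, roabpCertMatrix]
    exact coeff_roabpWitness h m π P Q l rr (u i) (w j)
  rw [hmat]
  exact hdet

/-- **Conjecture of record for the TT/ROABP door** (killable; census HOME/p1/g16/MEMO-ttdoor-g16.md §5/§9):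
every partition-minor layout admits a polynomial-width ROABP certificate. -/
@[conjecture] def ROABPHitsPartitionMinors : Prop :=
  ∃ c h₀ : ℕ, ∀ h : ℕ, h₀ ≤ h → ∀ (r : ℕ) (u w : Fin r → Finset (Fin h)),
    Function.Injective u → Function.Injective w →
    ∃ (m : ℕ) (_ : m ≤ (h + h) ^ c) (π : Equiv.Perm (Fin (h + h)))
      (P Q : Fin (h + h) → Matrix (Fin m) (Fin m) ℂ) (l rr : Fin m → ℂ),
      (roabpCertMatrix u w π P Q l rr).det ≠ 0

/-- **THE ARROW**: the conjecture implies item 19717 `PartitionMinorsHitByVP` (with `b = 3c + 3`). -/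
theorem partitionMinorsHitByVP_of_roabp (H : ROABPHitsPartitionMinors) : PartitionMinorsHitByVP := by
  obtain ⟨c, h₀, H⟩ := H
  refine ⟨3 * c + 3, max h₀ 2, fun h hh r u w hu hw => ?_⟩
  obtain ⟨m, hm, π, P, Q, l, rr, hdet⟩ := H h (le_of_max_le_left hh) r u w hu hw
  have h2 : 2 ≤ h := le_of_max_le_right hh
  exact partitionMinor_hit_of_roabpCertificate h m c hm (by omega) u w π P Q l rr hdet

/-! ### Addendum (planner p1 g16, 13:25Z): the h = 2 TOY KERNEL CERTIFICATE — director's step (a) in miniature, as ONE `example`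
(no new declarations ⇒ no `tree.orphan` audit flags). `∏_a (1 + x_a y_a)` as a width-2 ROABP in the order x₀ y₀ x₁ y₁
(state 0 = idle, state 1 = «x_a taken, y_a due»; «absent» tables keep idle and kill the due-state; «present» tables: x-positions
idle → due, y-positions due → idle), layout U = W = the full 2-cube ⇒ `roabpCertMatrix = 1`, and the DOOR turns the certificate
into a hit inside `SmallCircuits ℂ (2+2) 6`. Append inside the namespace of `BarrierLeverPartitionMinorsHitByVPRoabpDoor.lean`. -/
example : ∃ f ∈ Literature.Barriers.ValiantsHypothesis.SmallCircuits ℂ (2 + 2) (3 * 1 + 3),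
    (Matrix.of fun i j : Fin 4 => MvPolynomial.coeff
      (∑ a ∈ (![∅, {0}, {1}, {0, 1}] : Fin 4 → Finset (Fin 2)) i, Finsupp.single (Fin.castAdd 2 a) 1 +
        ∑ c ∈ (![∅, {0}, {1}, {0, 1}] : Fin 4 → Finset (Fin 2)) j, Finsupp.single (Fin.natAdd 2 c) 1) f).det ≠ 0 := by
  let U : Fin 4 → Finset (Fin 2) := ![∅, {0}, {1}, {0, 1}]
  let π : Equiv.Perm (Fin (2 + 2)) := Equiv.swap 1 2
  let P : Fin (2 + 2) → Matrix (Fin 2) (Fin 2) ℂ := fun _ => !![1, 0; 0, 0]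
  let Q : Fin (2 + 2) → Matrix (Fin 2) (Fin 2) ℂ := ![!![0, 1; 0, 0], !![0, 0; 1, 0], !![0, 1; 0, 0], !![0, 0; 1, 0]]
  let l : Fin 2 → ℂ := ![1, 0]
  have h1 : roabpCertMatrix U U π P Q l l = 1 := by
    ext i j
    fin_cases i <;> fin_cases j <;>
      simp (config := {decide := true, zetaDelta := true}) [roabpCertMatrix, monoVars, List.ofFn_succ,
        Matrix.mulVec, dotProduct, Fin.sum_univ_two, Equiv.swap_apply_def]
  have h2 : (roabpCertMatrix U U π P Q l l).det ≠ 0 := by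
    rw [h1, Matrix.det_one]; exact one_ne_zero
  exact partitionMinor_hit_of_roabpCertificate 2 2 1 (by norm_num) (le_refl _) U U π P Q l l h2

end Summit.ValiantsHypothesis.Theorems.BarrierLever.RoabpDoor
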